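import Summits.HodgeConjecture.CorCM.MumfordTateRankSevenSimpleIsogeny
import Literature.AlgebraicGeometry.HodgeTheory.SimpleAbelianSurfacePowersHodgeClasses
import Literature.AlgebraicGeometry.HodgeTheory.StablyNondegenerateProducts
import Literature.AlgebraicGeometry.HodgeTheory.FiniteProductsMixedPowersRetract
import Literature.AlgebraicGeometry.ComplexMultiplication.FieldOfDegreeTwoDimIsotypic
import Literature.AlgebraicGeometry.Motives.HodgeTensorPowerOpposedProofs
import Literature.AlgebraicGeometry.Motives.HodgeLieComplexCenter
import Literature.AlgebraicGeometry.Motives.HodgeLieWeightOneGradingSymmetry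
import HarnessLib

/-!
# The rung `dim MT(H¹(X)) = 7` with `ℚ`-SIMPLE Hodge Lie algebra, III: the Hodge conjecture for all powers in the
# real-multiplication shape, and the trichotomy of the rung

COR-CM (cell `pub-hodgecm2`, seat `b27` gen 40, count-neutral lane MT-RANK-SEVEN-SIMPLE; theorems only, no definition, no
named fact; UNCONDITIONAL — nothing here uses or asserts HC_CM).  Sequel of `CorCM/MumfordTateRankSevenSimpleIsogeny`.

* **`exists_shape_and_hodge_of_isSimple_of_finrank_gradingPlus_eq_two`** — for `0 < dim X`, `𝔷 = 0`, `dim MT(H¹X) = 7`,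
  `Lie Hg(H¹X)` `ℚ`-simple and `dim 𝔤⁺ = 2`: EITHER `X ∼ B^{m+1}` with `B` a SIMPLE ABELIAN SURFACE whose `End⁰` is a REAL
  QUADRATIC FIELD (type I(2) — real multiplication), and then `X` is STABLY NONDEGENERATE and the HODGE CONJECTURE HOLDS
  FOR `X` AND ALL ITS POWERS, UNCONDITIONALLY (the tree's `isStablyNondegenerate_of_isSimple_surface`, Moonen–Zarhin (2.2)),
  OR `X ∼ B^{m+1}` with `B` a simple FOURFOLD, `dim_ℚ End⁰B = 8` with centre a real quadratic field (type II(2) position).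
* **`trichotomy_of_isSimple_of_center_eq_bot_of_mtRank_eq_seven`** — basis-free summary of the rung `t = 7`, `𝔷 = 0`,
  `Lie Hg` `ℚ`-simple: (a) there is a Hodge-graded basis with `(dim 𝔤⁺, dim 𝔤⁻, dim 𝔤⁰) = (1, 1, 4)` (the type-III
  position of Moonen–Zarhin (2.3), left to the sequel), or (b) the real-multiplication shape with HC for all powers, or
  (c) the quaternion-fourfold shape; `projE_mul_projF_eq_smul_of_finrank_gradingPlus_eq_one` — in position (a) every rational
  `X₀ ∈ Lie Hg ∖ End_Hdg` has `E F = αP`, `F E = α(1 − P)` (`H¹(X,ℂ) ≅ std ⊗ W`).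
* **`classification_of_center_eq_bot_of_mtRank_eq_seven`**, **`classification_of_hasNoTypeIVFactor_of_mtRank_eq_seven`** — with
  gen 39's dichotomy: every `X` with `𝔷 = 0` (e.g. no factor of type IV) and `t = 7` is SPLIT (`B₁^{a+1} × B₂^{b+1}`, non-CM
  curves / QM surfaces), or in position (a), (b) or (c).

## References

* [MoonenZarhin1999LowDim] B. Moonen, Yu. Zarhin, *Hodge classes on abelian varieties of low dimension*, Math. Ann.
  315 (1999), §2 (2.2)–(2.3) and condition (D).
* [vanGeemen1994HodgeAV] B. van Geemen, *An introduction to the Hodge conjecture for abelian varieties* (1994), Lemma 3.7,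
  Thm. 4.6.
* [MumfordAV1970] D. Mumford, *Abelian Varieties* (1970), §19 Cor. 1–2 of Thm. 1 (pp. 173–174).
-/

noncomputable section

open scoped TensorProduct
open CategoryTheory CategoryTheory.Limits Module

namespace Summit.HodgeConjecture.CorCM

open Literature.AlgebraicGeometry.Motives
open Literature.AlgebraicGeometry.Motives.AbelianVariety
open Literature.AlgebraicGeometry.Motives.HodgeStructure
open Literature.AlgebraicGeometry.HodgeTheory
open Literature.AlgebraicGeometry.ComplexMultiplication (EndField isIsogenous_biproduct_powSucc)
open Literature.AlgebraicGeometry.Milne1999 (IsOfCMType)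

variable [HodgeTensorFacts.{0, 0}] {X : AbelianVariety ℂ} {n : ℕ}

/-- **The `Res_{K/ℚ} SL₂` position of the rung `dim MT(H¹X) = 7`: real multiplication by a real quadratic field on a
simple abelian surface `B` with `X ∼ B^{m+1}` — then `X` is stably nondegenerate and the Hodge conjecture holds for `X`
and all its powers, UNCONDITIONALLY — or a simple fourfold `B` with `dim_ℚ End⁰B = 8` and real quadratic centre.**
[cite: MoonenZarhin1999LowDim, §2 (2.2)–(2.3) and condition (D)] [cite: vanGeemen1994HodgeAV, Lemma 3.7 and Thm. 4.6]
[cite: MumfordAV1970, §19 Cor. 1–2 of Thm. 1 (pp. 173–174)] -/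
theorem exists_shape_and_hodge_of_isSimple_of_finrank_gradingPlus_eq_two (hX : IsSmoothProjective n X.X)
    (h0 : 0 < X.dim)
    (hz : haveI := BettiUniverse.finite hX 1
      (BettiUniverse.hodge exists_isReal_hodgeModel_holds hX 1).hodgeLie ⊓
        Subalgebra.toSubmodule (BettiUniverse.hodge exists_isReal_hodgeModel_holds hX 1).endAlg = ⊥)
    (h7 : haveI := BettiUniverse.finite hX 1
      (BettiUniverse.hodge exists_isReal_hodgeModel_holds hX 1).mtRank = 7)
    (hsimple : haveI := BettiUniverse.finite hX 1
      letI : LieRing (Module.End ℚ (bettiCohomology X.X 1)) := LieRing.ofAssociativeRing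
      ∀ 𝔏 : LieSubalgebra ℚ (Module.End ℚ (bettiCohomology X.X 1)),
        𝔏.toSubmodule = (BettiUniverse.hodge exists_isReal_hodgeModel_holds hX 1).hodgeLie → LieAlgebra.IsSimple ℚ 𝔏)
    {S : Type} [Fintype S] [DecidableEq S] {deg : S → ℤ} (e : Module.Basis S ℂ (ℂ ⊗[ℚ] bettiCohomology X.X 1))
    (hF : ∀ a, (BettiUniverse.hodge exists_isReal_hodgeModel_holds hX 1).F a = Submodule.span ℂ (e '' {σ | a ≤ deg σ}))
    (hFc : ∀ a, complexConj ((BettiUniverse.hodge exists_isReal_hodgeModel_holds hX 1).F a) =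
      Submodule.span ℂ (e '' {σ | deg σ ≤ ((1 : ℕ) : ℤ) - a}))
    (hp2 : haveI := BettiUniverse.finite hX 1
      Module.finrank ℂ ((BettiUniverse.hodge exists_isReal_hodgeModel_holds hX 1).hodgeLieC ⊓ Module.End.eigenspace
        (LinearMap.mulLeft ℂ (gradingEnd e deg) - LinearMap.mulRight ℂ (gradingEnd e deg)) 1 : Submodule ℂ _) = 2) :
    (∃ (B : AbelianVariety ℂ) (m : ℕ) (hF : IsField B.endAlgebra),
        B.IsSimple ∧ B.dim = 2 ∧ Module.finrank ℚ B.endAlgebra = 2 ∧ NumberField.IsTotallyReal (EndField B hF) ∧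
        IsIsogenous X (B.powSucc m) ∧ X.dim = (m + 1) * 2 ∧ Module.finrank ℚ X.endAlgebra = (m + 1) ^ 2 * 2 ∧
        IsStablyNondegenerate X ∧ ∀ N : ℕ, HodgeConjectureFor (X.powSucc N).dim (X.powSucc N).X) ∨
      (∃ (B : AbelianVariety ℂ) (m : ℕ) (φ : B.endAlgebra) (q : ℚ),
        B.IsSimple ∧ B.dim = 4 ∧ Module.finrank ℚ B.endAlgebra = 8 ∧
        Module.finrank ℚ (Subalgebra.center ℚ B.endAlgebra) = 2 ∧ φ ∈ Subalgebra.center ℚ B.endAlgebra ∧ 0 < q ∧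
        ¬ IsSquare q ∧ φ * φ = algebraMap ℚ B.endAlgebra q ∧
        (∀ z ∈ Subalgebra.center ℚ B.endAlgebra, ∃ a b : ℚ, z = algebraMap ℚ B.endAlgebra a + b • φ) ∧
        IsIsogenous X (B.powSucc m) ∧ X.dim = (m + 1) * 4 ∧ Module.finrank ℚ X.endAlgebra = (m + 1) ^ 2 * 8) := by
  obtain ⟨B, m, k₁, k₂, φ, q, hBs, hB0, hXB, hdimXB, -, -, -, -, -, hEXB, hZB, hφc, hq, hnsq, hφsq, hspan, hcases⟩ :=
    exists_isIsogenous_power_of_isSimple_of_finrank_gradingPlus_eq_two hX h0 hz h7 hsimple e hF hFc hp2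
  have hXP : IsIsogenous X (B.powSucc m) := hXB.trans (isIsogenous_biproduct_powSucc B m)
  rcases hcases with ⟨hB2, hE2, -, hF⟩ | ⟨hB4, hE8⟩
  · left
    have hSN : IsStablyNondegenerate X :=
      ((AbelianVariety.isStablyNondegenerate_of_isSimple_surface B hBs hB2).powSucc m).of_isIsogenous hXP
    refine ⟨B, m, hF, hBs, hB2, hE2, AbelianVariety.isTotallyReal_endField_of_surface hB2 hE2 hF, hXP, ?_, ?_, hSN,
      hSN.hodgeConjectureFor_powSucc⟩
    · rw [hdimXB, hB2]
    · rw [hEXB, hE2]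
  · right
    refine ⟨B, m, φ, q, hBs, hB4, hE8, hZB, hφc, hq, hnsq, hφsq, hspan, hXP, ?_, ?_⟩
    · rw [hdimXB, hB4]
    · rw [hEXB, hE8]

/-- **The type-III position of the rung `dim MT(H¹X) = 7`: if `dim 𝔤⁺ = 1` (and `𝔷 = 0`) then for EVERY rational
`X₀ ∈ Lie Hg(H¹X) ∖ End_Hdg` the blocks `E = P X₀ (1 − P)`, `F = (1 − P) X₀ P` satisfy `E F = αP`, `F E = α(1 − P)`,
`E F + F E = α ≠ 0`** — `H¹(X, ℂ) = E H¹ ⊕ F H¹ ≅ std ⊗ W` for the `𝔰𝔩₂`-triple `⟨E, F, [E,F]⟩` (the tree's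
`plusLine_of_finrank_gradingPlus_eq_one` feeding `projE_mul_projF_eq_smul_of_plusLine_of_center_eq_bot`).
[cite: MoonenZarhin1999LowDim, §2 and (2.3)] [cite: Deligne1982HodgeCycles, I §3 (proof of Prop. 3.4)] -/
theorem projE_mul_projF_eq_smul_of_finrank_gradingPlus_eq_one (hX : IsSmoothProjective n X.X)
    (hz : haveI := BettiUniverse.finite hX 1
      (BettiUniverse.hodge exists_isReal_hodgeModel_holds hX 1).hodgeLie ⊓
        Subalgebra.toSubmodule (BettiUniverse.hodge exists_isReal_hodgeModel_holds hX 1).endAlg = ⊥)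
    {S : Type} [Fintype S] [DecidableEq S] {deg : S → ℤ} (e : Module.Basis S ℂ (ℂ ⊗[ℚ] bettiCohomology X.X 1))
    (hF : ∀ a, (BettiUniverse.hodge exists_isReal_hodgeModel_holds hX 1).F a = Submodule.span ℂ (e '' {σ | a ≤ deg σ}))
    (hFc : ∀ a, complexConj ((BettiUniverse.hodge exists_isReal_hodgeModel_holds hX 1).F a) =
      Submodule.span ℂ (e '' {σ | deg σ ≤ ((1 : ℕ) : ℤ) - a}))
    (hp1 : haveI := BettiUniverse.finite hX 1
      Module.finrank ℂ ((BettiUniverse.hodge exists_isReal_hodgeModel_holds hX 1).hodgeLieC ⊓ Module.End.eigenspace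
        (LinearMap.mulLeft ℂ (gradingEnd e deg) - LinearMap.mulRight ℂ (gradingEnd e deg)) 1 : Submodule ℂ _) = 1)
    (hm1 : haveI := BettiUniverse.finite hX 1
      Module.finrank ℂ ((BettiUniverse.hodge exists_isReal_hodgeModel_holds hX 1).hodgeLieC ⊓ Module.End.eigenspace
        (LinearMap.mulLeft ℂ (gradingEnd e deg) - LinearMap.mulRight ℂ (gradingEnd e deg)) (-1) : Submodule ℂ _) = 1)
    {X₀ : Module.End ℚ (bettiCohomology X.X 1)}
    (hX₀ : haveI := BettiUniverse.finite hX 1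
      X₀ ∈ (BettiUniverse.hodge exists_isReal_hodgeModel_holds hX 1).hodgeLie)
    (hX₀E : haveI := BettiUniverse.finite hX 1
      X₀ ∉ (BettiUniverse.hodge exists_isReal_hodgeModel_holds hX 1).endAlg) :
    ∃ α : ℂ, α ≠ 0 ∧
      (gradingEnd e deg * X₀.baseChange ℂ * (1 - gradingEnd e deg)) *
          ((1 - gradingEnd e deg) * X₀.baseChange ℂ * gradingEnd e deg) = α • gradingEnd e deg ∧
      ((1 - gradingEnd e deg) * X₀.baseChange ℂ * gradingEnd e deg) *
          (gradingEnd e deg * X₀.baseChange ℂ * (1 - gradingEnd e deg)) = α • (1 - gradingEnd e deg) ∧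
      (gradingEnd e deg * X₀.baseChange ℂ * (1 - gradingEnd e deg)) *
            ((1 - gradingEnd e deg) * X₀.baseChange ℂ * gradingEnd e deg) +
          ((1 - gradingEnd e deg) * X₀.baseChange ℂ * gradingEnd e deg) *
            (gradingEnd e deg * X₀.baseChange ℂ * (1 - gradingEnd e deg)) = α • 1 := by
  haveI := BettiUniverse.finite hX 1
  set H := BettiUniverse.hodge exists_isReal_hodgeModel_holds hX 1 with hH
  have heff := BettiUniverse.hodge_isEffective exists_isReal_hodgeModel_holds hX 1
  have hdeg : ∀ σ, deg σ = 0 ∨ deg σ = 1 := fun σ => by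
    have h := heff.deg_mem_Icc_of_graded e hF hFc σ
    simp only [Nat.cast_one] at h
    omega
  obtain ⟨ψ⟩ := BettiUniverse.hodge_isPolarizable exists_isReal_hodgeModel_holds hX 1
  obtain ⟨hplus, hminus⟩ := plusLine_of_finrank_gradingPlus_eq_one H (by simp) e hF hFc hdeg hX₀ hX₀E
  exact projE_mul_projF_eq_smul_of_plusLine_of_center_eq_bot H ψ (by simp) e hF hFc hdeg hX₀ hX₀E (hplus hp1) (hminus hm1) hz

/-- **Trichotomy of the rung `dim MT(H¹X) = 7` with `𝔷 = 0` and `ℚ`-simple Hodge Lie algebra** (basis-free): (a) some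
Hodge-graded basis of `H¹(X, ℂ)` has `(dim 𝔤⁺, dim 𝔤⁻, dim 𝔤⁰) = (1, 1, 4)` for the `ad P`-grading, and then every
rational `X₀ ∈ Lie Hg ∖ End_Hdg` has blocks with `E F = αP`, `F E = α(1 − P)`, `α ≠ 0` (`H¹(X,ℂ) ≅ std ⊗ W`: the type-III
position of Moonen–Zarhin (2.3)); or (b) `X ∼ B^{m+1}`, `B` a simple abelian surface with real multiplication by a real quadratic
field — `X` stably nondegenerate, the Hodge conjecture for `X` and all its powers; or (c) `X ∼ B^{m+1}`, `B` a simple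
fourfold with `dim_ℚ End⁰B = 8` and real quadratic centre. [cite: MoonenZarhin1999LowDim, §2 (2.2)–(2.3) and condition (D)]
[cite: vanGeemen1994HodgeAV, Lemma 3.7 and Thm. 4.6] [cite: MumfordAV1970, §19 Cor. 1–2 of Thm. 1 (pp. 173–174)] -/
theorem trichotomy_of_isSimple_of_center_eq_bot_of_mtRank_eq_seven (hX : IsSmoothProjective n X.X) (h0 : 0 < X.dim)
    (hz : haveI := BettiUniverse.finite hX 1
      (BettiUniverse.hodge exists_isReal_hodgeModel_holds hX 1).hodgeLie ⊓
        Subalgebra.toSubmodule (BettiUniverse.hodge exists_isReal_hodgeModel_holds hX 1).endAlg = ⊥)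
    (h7 : haveI := BettiUniverse.finite hX 1
      (BettiUniverse.hodge exists_isReal_hodgeModel_holds hX 1).mtRank = 7)
    (hsimple : haveI := BettiUniverse.finite hX 1
      letI : LieRing (Module.End ℚ (bettiCohomology X.X 1)) := LieRing.ofAssociativeRing
      ∀ 𝔏 : LieSubalgebra ℚ (Module.End ℚ (bettiCohomology X.X 1)),
        𝔏.toSubmodule = (BettiUniverse.hodge exists_isReal_hodgeModel_holds hX 1).hodgeLie → LieAlgebra.IsSimple ℚ 𝔏) :
    (∃ (S : Type) (_ : Fintype S) (_ : DecidableEq S) (deg : S → ℤ) (e : Module.Basis S ℂ (ℂ ⊗[ℚ] bettiCohomology X.X 1)),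
        (∀ a, (BettiUniverse.hodge exists_isReal_hodgeModel_holds hX 1).F a = Submodule.span ℂ (e '' {σ | a ≤ deg σ})) ∧
        (∀ a, complexConj ((BettiUniverse.hodge exists_isReal_hodgeModel_holds hX 1).F a) =
          Submodule.span ℂ (e '' {σ | deg σ ≤ ((1 : ℕ) : ℤ) - a})) ∧
        haveI := BettiUniverse.finite hX 1
        (Module.finrank ℂ ((BettiUniverse.hodge exists_isReal_hodgeModel_holds hX 1).hodgeLieC ⊓ Module.End.eigenspace
            (LinearMap.mulLeft ℂ (gradingEnd e deg) - LinearMap.mulRight ℂ (gradingEnd e deg)) 1 : Submodule ℂ _) = 1 ∧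
          Module.finrank ℂ ((BettiUniverse.hodge exists_isReal_hodgeModel_holds hX 1).hodgeLieC ⊓ Module.End.eigenspace
            (LinearMap.mulLeft ℂ (gradingEnd e deg) - LinearMap.mulRight ℂ (gradingEnd e deg)) (-1) : Submodule ℂ _) = 1 ∧
          Module.finrank ℂ ((BettiUniverse.hodge exists_isReal_hodgeModel_holds hX 1).hodgeLieC ⊓ Module.End.eigenspace
            (LinearMap.mulLeft ℂ (gradingEnd e deg) - LinearMap.mulRight ℂ (gradingEnd e deg)) 0 : Submodule ℂ _) = 4) ∧
        ∀ X₀ ∈ (BettiUniverse.hodge exists_isReal_hodgeModel_holds hX 1).hodgeLie,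
          X₀ ∉ (BettiUniverse.hodge exists_isReal_hodgeModel_holds hX 1).endAlg →
          ∃ α : ℂ, α ≠ 0 ∧
            (gradingEnd e deg * X₀.baseChange ℂ * (1 - gradingEnd e deg)) *
                ((1 - gradingEnd e deg) * X₀.baseChange ℂ * gradingEnd e deg) = α • gradingEnd e deg ∧
            ((1 - gradingEnd e deg) * X₀.baseChange ℂ * gradingEnd e deg) *
                (gradingEnd e deg * X₀.baseChange ℂ * (1 - gradingEnd e deg)) = α • (1 - gradingEnd e deg)) ∨
      (∃ (B : AbelianVariety ℂ) (m : ℕ) (hF : IsField B.endAlgebra),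
        B.IsSimple ∧ B.dim = 2 ∧ Module.finrank ℚ B.endAlgebra = 2 ∧ NumberField.IsTotallyReal (EndField B hF) ∧
        IsIsogenous X (B.powSucc m) ∧ X.dim = (m + 1) * 2 ∧ Module.finrank ℚ X.endAlgebra = (m + 1) ^ 2 * 2 ∧
        IsStablyNondegenerate X ∧ ∀ N : ℕ, HodgeConjectureFor (X.powSucc N).dim (X.powSucc N).X) ∨
      (∃ (B : AbelianVariety ℂ) (m : ℕ) (φ : B.endAlgebra) (q : ℚ),
        B.IsSimple ∧ B.dim = 4 ∧ Module.finrank ℚ B.endAlgebra = 8 ∧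
        Module.finrank ℚ (Subalgebra.center ℚ B.endAlgebra) = 2 ∧ φ ∈ Subalgebra.center ℚ B.endAlgebra ∧ 0 < q ∧
        ¬ IsSquare q ∧ φ * φ = algebraMap ℚ B.endAlgebra q ∧
        (∀ z ∈ Subalgebra.center ℚ B.endAlgebra, ∃ a b : ℚ, z = algebraMap ℚ B.endAlgebra a + b • φ) ∧
        IsIsogenous X (B.powSucc m) ∧ X.dim = (m + 1) * 4 ∧ Module.finrank ℚ X.endAlgebra = (m + 1) ^ 2 * 8) := by
  classical
  haveI := BettiUniverse.finite hX 1
  obtain ⟨S, deg, e, hF, hFc⟩ := exists_basis_F_eq_span (BettiUniverse.hodge exists_isReal_hodgeModel_holds hX 1)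
  haveI : Fintype S := FiniteDimensional.fintypeBasisIndex e
  rcases finrank_grading_dichotomy_of_center_eq_bot_of_mtRank_eq_seven hX h0 hz h7 e hF hFc with h1 | h2
  · refine Or.inl ⟨S, inferInstance, inferInstance, deg, e, hF, hFc, h1, fun X₀ hX₀ hX₀E => ?_⟩
    obtain ⟨α, hα, hEF, hFE, -⟩ :=
      projE_mul_projF_eq_smul_of_finrank_gradingPlus_eq_one hX hz e hF hFc h1.1 h1.2.1 hX₀ hX₀E
    exact ⟨α, hα, hEF, hFE⟩
  · exact Or.inr (exists_shape_and_hodge_of_isSimple_of_finrank_gradingPlus_eq_two hX h0 hz h7 hsimple e hF hFc h2.1)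

/-- **The rung `dim MT(H¹X) = 7` with `𝔷 = Lie Hg ∩ End_Hdg = 0`, classified into FOUR positions** (gen 39's dichotomy
«`Lie Hg` ℚ-simple ∨ split» followed by the trichotomy of the simple case): (i) SPLIT `X ∼ B₁^{a+1} × B₂^{b+1}` with `B₁ ≁ B₂`
non-CM elliptic curves / quaternion surfaces; (ii) TYPE-III position (`(1,1,4)`-grading, `E F = αP`, `F E = α(1−P)`);
(iii) REAL MULTIPLICATION `X ∼ B^{m+1}`, `B` a simple RM surface — `X` stably nondegenerate, HC for all powers; (iv) `X ∼ B^{m+1}`,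
`B` a simple fourfold with `dim_ℚ End⁰B = 8` and real quadratic centre. [cite: MoonenZarhin1999LowDim, §1, §2 (2.2)–(2.3), §3 (3.1) and Cor. (3.7)]
[cite: vanGeemen1994HodgeAV, Lemma 3.7 and Thm. 4.6] [cite: MumfordAV1970, §19 Cor. 1–2 of Thm. 1 (pp. 173–174)] -/
theorem classification_of_center_eq_bot_of_mtRank_eq_seven (hX : IsSmoothProjective n X.X) (h0 : 0 < X.dim)
    (hz : haveI := BettiUniverse.finite hX 1
      (BettiUniverse.hodge exists_isReal_hodgeModel_holds hX 1).hodgeLie ⊓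
        Subalgebra.toSubmodule (BettiUniverse.hodge exists_isReal_hodgeModel_holds hX 1).endAlg = ⊥)
    (h7 : haveI := BettiUniverse.finite hX 1
      (BettiUniverse.hodge exists_isReal_hodgeModel_holds hX 1).mtRank = 7) :
    (∃ (B₁ B₂ : AbelianVariety ℂ) (a b : ℕ), B₁.IsSimple ∧ B₂.IsSimple ∧ 0 < B₁.dim ∧ B₁.dim ≤ 2 ∧ 0 < B₂.dim ∧
        B₂.dim ≤ 2 ∧ ¬ IsOfCMType B₁ ∧ ¬ IsOfCMType B₂ ∧
        Module.finrank ℚ B₁.endAlgebra = B₁.dim ^ 2 ∧ Module.finrank ℚ (Subalgebra.center ℚ B₁.endAlgebra) = 1 ∧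
        Module.finrank ℚ B₂.endAlgebra = B₂.dim ^ 2 ∧ Module.finrank ℚ (Subalgebra.center ℚ B₂.endAlgebra) = 1 ∧
        (∀ f : B₁ ⟶ B₂, f = 0) ∧ (∀ f : B₂ ⟶ B₁, f = 0) ∧ ¬ IsIsogenous B₁ B₂ ∧
        IsIsogenous X ((B₁.powSucc a).prod (B₂.powSucc b)) ∧ (a + 1) * B₁.dim + (b + 1) * B₂.dim = X.dim ∧
        ¬ IsOfCMType X) ∨
      (∃ (S : Type) (_ : Fintype S) (_ : DecidableEq S) (deg : S → ℤ) (e : Module.Basis S ℂ (ℂ ⊗[ℚ] bettiCohomology X.X 1)),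
        (∀ a, (BettiUniverse.hodge exists_isReal_hodgeModel_holds hX 1).F a = Submodule.span ℂ (e '' {σ | a ≤ deg σ})) ∧
        (∀ a, complexConj ((BettiUniverse.hodge exists_isReal_hodgeModel_holds hX 1).F a) =
          Submodule.span ℂ (e '' {σ | deg σ ≤ ((1 : ℕ) : ℤ) - a})) ∧
        haveI := BettiUniverse.finite hX 1
        (Module.finrank ℂ ((BettiUniverse.hodge exists_isReal_hodgeModel_holds hX 1).hodgeLieC ⊓ Module.End.eigenspace
            (LinearMap.mulLeft ℂ (gradingEnd e deg) - LinearMap.mulRight ℂ (gradingEnd e deg)) 1 : Submodule ℂ _) = 1 ∧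
          Module.finrank ℂ ((BettiUniverse.hodge exists_isReal_hodgeModel_holds hX 1).hodgeLieC ⊓ Module.End.eigenspace
            (LinearMap.mulLeft ℂ (gradingEnd e deg) - LinearMap.mulRight ℂ (gradingEnd e deg)) (-1) : Submodule ℂ _) = 1 ∧
          Module.finrank ℂ ((BettiUniverse.hodge exists_isReal_hodgeModel_holds hX 1).hodgeLieC ⊓ Module.End.eigenspace
            (LinearMap.mulLeft ℂ (gradingEnd e deg) - LinearMap.mulRight ℂ (gradingEnd e deg)) 0 : Submodule ℂ _) = 4) ∧
        ∀ X₀ ∈ (BettiUniverse.hodge exists_isReal_hodgeModel_holds hX 1).hodgeLie,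
          X₀ ∉ (BettiUniverse.hodge exists_isReal_hodgeModel_holds hX 1).endAlg →
          ∃ α : ℂ, α ≠ 0 ∧
            (gradingEnd e deg * X₀.baseChange ℂ * (1 - gradingEnd e deg)) *
                ((1 - gradingEnd e deg) * X₀.baseChange ℂ * gradingEnd e deg) = α • gradingEnd e deg ∧
            ((1 - gradingEnd e deg) * X₀.baseChange ℂ * gradingEnd e deg) *
                (gradingEnd e deg * X₀.baseChange ℂ * (1 - gradingEnd e deg)) = α • (1 - gradingEnd e deg)) ∨
      (∃ (B : AbelianVariety ℂ) (m : ℕ) (hF : IsField B.endAlgebra),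
        B.IsSimple ∧ B.dim = 2 ∧ Module.finrank ℚ B.endAlgebra = 2 ∧ NumberField.IsTotallyReal (EndField B hF) ∧
        IsIsogenous X (B.powSucc m) ∧ X.dim = (m + 1) * 2 ∧ Module.finrank ℚ X.endAlgebra = (m + 1) ^ 2 * 2 ∧
        IsStablyNondegenerate X ∧ ∀ N : ℕ, HodgeConjectureFor (X.powSucc N).dim (X.powSucc N).X) ∨
      (∃ (B : AbelianVariety ℂ) (m : ℕ) (φ : B.endAlgebra) (q : ℚ),
        B.IsSimple ∧ B.dim = 4 ∧ Module.finrank ℚ B.endAlgebra = 8 ∧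
        Module.finrank ℚ (Subalgebra.center ℚ B.endAlgebra) = 2 ∧ φ ∈ Subalgebra.center ℚ B.endAlgebra ∧ 0 < q ∧
        ¬ IsSquare q ∧ φ * φ = algebraMap ℚ B.endAlgebra q ∧
        (∀ z ∈ Subalgebra.center ℚ B.endAlgebra, ∃ a b : ℚ, z = algebraMap ℚ B.endAlgebra a + b • φ) ∧
        IsIsogenous X (B.powSucc m) ∧ X.dim = (m + 1) * 4 ∧ Module.finrank ℚ X.endAlgebra = (m + 1) ^ 2 * 8) := by
  haveI := BettiUniverse.finite hX 1
  rcases isSimple_or_exists_isIsogenous_powSucc_prod_powSucc_of_center_eq_bot_of_mtRank_eq_seven hX h0 hz h7 with h | h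
  · exact Or.inr (trichotomy_of_isSimple_of_center_eq_bot_of_mtRank_eq_seven hX h0 hz h7 h)
  · exact Or.inl h

/-- **Every complex abelian variety with NO FACTOR OF TYPE IV and `dim MT(H¹X) = 7` is in one of the four positions** of
`classification_of_center_eq_bot_of_mtRank_eq_seven` (no type-IV factor ⟹ `𝔷 = 0`, the tree's
`hodgeLie_hodge_one_inf_endAlg_eq_bot_of_hasNoTypeIVFactor`); in positions (i) with curves and (iii) the Hodge conjecture
holds for `X` and all its powers unconditionally (this file and gen 39's `MumfordTateRankSevenSplitHodge`).
[cite: MoonenZarhin1999LowDim, §1, §2 (2.2)–(2.3), §3 (3.1) and Cor. (3.7)] [cite: vanGeemen1994HodgeAV, Lemma 3.7 and Thm. 4.6] -/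
theorem classification_of_hasNoTypeIVFactor_of_mtRank_eq_seven (hX : IsSmoothProjective n X.X) (h0 : 0 < X.dim)
    (hA4 : HasNoTypeIVFactor X)
    (h7 : haveI := BettiUniverse.finite hX 1
      (BettiUniverse.hodge exists_isReal_hodgeModel_holds hX 1).mtRank = 7) :
    (∃ (B₁ B₂ : AbelianVariety ℂ) (a b : ℕ), B₁.IsSimple ∧ B₂.IsSimple ∧ 0 < B₁.dim ∧ B₁.dim ≤ 2 ∧ 0 < B₂.dim ∧
        B₂.dim ≤ 2 ∧ ¬ IsOfCMType B₁ ∧ ¬ IsOfCMType B₂ ∧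
        Module.finrank ℚ B₁.endAlgebra = B₁.dim ^ 2 ∧ Module.finrank ℚ (Subalgebra.center ℚ B₁.endAlgebra) = 1 ∧
        Module.finrank ℚ B₂.endAlgebra = B₂.dim ^ 2 ∧ Module.finrank ℚ (Subalgebra.center ℚ B₂.endAlgebra) = 1 ∧
        (∀ f : B₁ ⟶ B₂, f = 0) ∧ (∀ f : B₂ ⟶ B₁, f = 0) ∧ ¬ IsIsogenous B₁ B₂ ∧
        IsIsogenous X ((B₁.powSucc a).prod (B₂.powSucc b)) ∧ (a + 1) * B₁.dim + (b + 1) * B₂.dim = X.dim ∧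
        ¬ IsOfCMType X) ∨
      (∃ (S : Type) (_ : Fintype S) (_ : DecidableEq S) (deg : S → ℤ) (e : Module.Basis S ℂ (ℂ ⊗[ℚ] bettiCohomology X.X 1)),
        (∀ a, (BettiUniverse.hodge exists_isReal_hodgeModel_holds hX 1).F a = Submodule.span ℂ (e '' {σ | a ≤ deg σ})) ∧
        (∀ a, complexConj ((BettiUniverse.hodge exists_isReal_hodgeModel_holds hX 1).F a) =
          Submodule.span ℂ (e '' {σ | deg σ ≤ ((1 : ℕ) : ℤ) - a})) ∧
        haveI := BettiUniverse.finite hX 1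
        (Module.finrank ℂ ((BettiUniverse.hodge exists_isReal_hodgeModel_holds hX 1).hodgeLieC ⊓ Module.End.eigenspace
            (LinearMap.mulLeft ℂ (gradingEnd e deg) - LinearMap.mulRight ℂ (gradingEnd e deg)) 1 : Submodule ℂ _) = 1 ∧
          Module.finrank ℂ ((BettiUniverse.hodge exists_isReal_hodgeModel_holds hX 1).hodgeLieC ⊓ Module.End.eigenspace
            (LinearMap.mulLeft ℂ (gradingEnd e deg) - LinearMap.mulRight ℂ (gradingEnd e deg)) (-1) : Submodule ℂ _) = 1 ∧
          Module.finrank ℂ ((BettiUniverse.hodge exists_isReal_hodgeModel_holds hX 1).hodgeLieC ⊓ Module.End.eigenspace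
            (LinearMap.mulLeft ℂ (gradingEnd e deg) - LinearMap.mulRight ℂ (gradingEnd e deg)) 0 : Submodule ℂ _) = 4) ∧
        ∀ X₀ ∈ (BettiUniverse.hodge exists_isReal_hodgeModel_holds hX 1).hodgeLie,
          X₀ ∉ (BettiUniverse.hodge exists_isReal_hodgeModel_holds hX 1).endAlg →
          ∃ α : ℂ, α ≠ 0 ∧
            (gradingEnd e deg * X₀.baseChange ℂ * (1 - gradingEnd e deg)) *
                ((1 - gradingEnd e deg) * X₀.baseChange ℂ * gradingEnd e deg) = α • gradingEnd e deg ∧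
            ((1 - gradingEnd e deg) * X₀.baseChange ℂ * gradingEnd e deg) *
                (gradingEnd e deg * X₀.baseChange ℂ * (1 - gradingEnd e deg)) = α • (1 - gradingEnd e deg)) ∨
      (∃ (B : AbelianVariety ℂ) (m : ℕ) (hF : IsField B.endAlgebra),
        B.IsSimple ∧ B.dim = 2 ∧ Module.finrank ℚ B.endAlgebra = 2 ∧ NumberField.IsTotallyReal (EndField B hF) ∧
        IsIsogenous X (B.powSucc m) ∧ X.dim = (m + 1) * 2 ∧ Module.finrank ℚ X.endAlgebra = (m + 1) ^ 2 * 2 ∧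
        IsStablyNondegenerate X ∧ ∀ N : ℕ, HodgeConjectureFor (X.powSucc N).dim (X.powSucc N).X) ∨
      (∃ (B : AbelianVariety ℂ) (m : ℕ) (φ : B.endAlgebra) (q : ℚ),
        B.IsSimple ∧ B.dim = 4 ∧ Module.finrank ℚ B.endAlgebra = 8 ∧
        Module.finrank ℚ (Subalgebra.center ℚ B.endAlgebra) = 2 ∧ φ ∈ Subalgebra.center ℚ B.endAlgebra ∧ 0 < q ∧
        ¬ IsSquare q ∧ φ * φ = algebraMap ℚ B.endAlgebra q ∧
        (∀ z ∈ Subalgebra.center ℚ B.endAlgebra, ∃ a b : ℚ, z = algebraMap ℚ B.endAlgebra a + b • φ) ∧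
        IsIsogenous X (B.powSucc m) ∧ X.dim = (m + 1) * 4 ∧ Module.finrank ℚ X.endAlgebra = (m + 1) ^ 2 * 8) :=
  classification_of_center_eq_bot_of_mtRank_eq_seven hX h0 (hodgeLie_hodge_one_inf_endAlg_eq_bot_of_hasNoTypeIVFactor hX hA4) h7

end Summit.HodgeConjecture.CorCM

end
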